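import Literature.NumberTheory.Sieve.AsymptoticSieveForPrimesS2Rough
import HarnessLib

/-!
# Asymptotic sieve for primes under (B*) with saving `(log x)^{-2^{22}}`: the estimate (7.2) of `S₂(x; Y, z)`

Topic `Literature/NumberTheory/Sieve` (trunk T-SIEVE), a sequel of
`Literature.NumberTheory.Sieve.AsymptoticSieveForPrimesRoughWeak` and `…S2Rough`. Source:
J. Friedlander, H. Iwaniec, *Asymptotic sieve for primes*, Ann. of Math. 148 (1998) 1041–1065
[FriedlanderIwaniecASP1998] (= arXiv:math/9811186), §7 (7.1)–(7.2) and §10 (Theorem 3,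
(10.4)–(10.5), pp. 1063–1065).

The tree's `fi_asp_S2_estimate_rough_holds` (`…S2Rough`) proves FI (7.2),
`|∫_Y^{eY} S₂(x; y, z) dy/y| ≤ K A(x)/log x`, over the regime `FIRegimeRough`, whose hypothesis bundle
demands (B*) with the constant `1` and the saving `(log x)^{-2^{26}}`. Its proof consumes (B*) only
through the reduced weighted bound `∑_m 6^{ω(m)} |∑*_n γ μ a| ≤ K_B A(x)(log x)^{-5}`
(`reduced_rough_bilinear_bound_six` at `k = 5`). This file records the SAME proof with the regime
unbundled: the literal hypotheses of Theorem 1 with void bilinear parameters, the parameter clause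
(10.2) for `δ = (log x)^α`, `Δ_B = x^{2θ}`, the weights, and the reduced weighted bound itself are
passed as arguments (`fi_asp_S2_estimate_rough_of_reducedBound`). Fed with
`reduced_rough_bilinear_bound_six_of_le` (`…RoughWeak`) it gives (7.2) under (B*) with the printed
saving `(log x)^{-2^{22}}` of Theorem 1, which is what FI's Theorem 2 (§9, arbitrary support:
[FriedlanderIwaniecAnnals1998] Proposition 2.1) can supply for `μ²(n) a_n` (p. 1062, "we saved at
least a factor `log x` which is needed for clearing the implied constants"). The proof body is that of
`fi_asp_S2_estimate_rough_holds`, verbatim.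

## References

* J. Friedlander, H. Iwaniec, *Asymptotic sieve for primes*, Ann. of Math. 148 (1998), 1041–1065,
  §7 (7.1)–(7.2), §9 p. 1062 and §10 Theorem 3. [cite: FriedlanderIwaniecASP1998, §7 (7.2) and §10 Theorem 3]

## Mathlib / tree search

Everything used is in `…S2Rough` (and its imports `…S3Rough`, `…S2`, `…SmoothRough`, `…Reduction`);
`lean search 'of_reducedBound'`: no declaration before this file.
-/

noncomputable section

open Filter Finset
open scoped ArithmeticFunction.Moebius ArithmeticFunction.vonMangoldt ArithmeticFunction.zeta
  ArithmeticFunction.omega ArithmeticFunction.sigma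

namespace Literature.NumberTheory.Sieve

open MeasureTheory
open scoped Topology

set_option maxHeartbeats 400000 in -- verbatim copy of `fi_asp_S2_estimate_rough_holds`, same budget as there
/-- **FI (7.2) under (B*), regime unbundled**: for `α > 0`, `0 < θ₁ ≤ θ/2`, `θ < 1/6`, a sequence
with the literal hypotheses of Theorem 1 (void bilinear parameters), the parameter clause
`2 ≤ (log x)^α`, `2 ≤ x^{2θ}`, `2 ≤ P ≤ (x^{2θ})^{1/(2^{35} log log x)}` ((10.2)), upper-bound sieve weights
of sifting range `x^{θ₁}` and level `x^{θ/2}`, and the reduced sieved bilinear bound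
`∑_m 6^{ω(m)} |∑_{N<n≤2N, mn≤x, (n,Π)=1} γ(n;C) μ(mn) a_{mn}| ≤ K_B A(x)(log x)^{-5}` for
`x^{-2θ}√D < N < (log x)^{-α}√x`, `1 ≤ C ≤ x/D`: there is `K` with
`|S₂(x; Y, z)| = |∫_Y^{eY} S₂(x; y, z) dy/y| ≤ K A(x)/log x` for all large `x`, every admissible
splitting parameter `s` and `Y ≤ z ≤ eY` (`Y = x^{-θ/2}√D`). Proof: that of
`fi_asp_S2_estimate_rough_holds`. [cite: FriedlanderIwaniecASP1998, §7 (7.2) and §10 Theorem 3] -/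
theorem fi_asp_S2_estimate_rough_of_reducedBound (A : SieveSequence) (D : ℝ → ℝ) (α θ θ₁ : ℝ)
    (lam : ℝ → ℕ → ℤ) (P : ℝ → ℝ) (hαpos : 0 < α) (hθ₁pos : 0 < θ₁) (hθ₁le : θ₁ ≤ θ / 2)
    (hθlt : θ < 1 / 6)
    (hhyp : A.FIAsymptoticSieveHypotheses D (fun x => 2 * Real.sqrt x) (fun _ => 2))
    (hparams : ∀ᶠ x : ℝ in atTop, 2 ≤ Real.log x ^ α ∧ 2 ≤ x ^ (2 * θ) ∧ 2 ≤ P x ∧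
      P x ≤ (x ^ (2 * θ)) ^ (1 / (2 ^ 35 * Real.log (Real.log x))))
    (hweights : ∀ᶠ x : ℝ in atTop, IsUpperSieveWeights (x ^ θ₁) (x ^ (θ / 2)) (lam x))
    (hKBex : ∃ KB : ℝ, ∀ᶠ x : ℝ in atTop, ∀ N : ℝ, Real.sqrt (D x) / x ^ (2 * θ) < N →
      N < Real.sqrt x / Real.log x ^ α → ∀ C : ℝ, 1 ≤ C → C ≤ x / D x →
        ∑ m ∈ Icc 1 ⌊x⌋₊, (6 : ℝ) ^ m.primeFactors.card *
          |∑ n ∈ (Ioc ⌊N⌋₊ ⌊2 * N⌋₊).filter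
              (fun n : ℕ => ((m * n : ℕ) : ℝ) ≤ x ∧ ∀ p ∈ n.primeFactors, P x ≤ (p : ℝ)),
            (SieveSequence.fiGamma C n : ℝ) * (μ (m * n) : ℝ) * A.a (m * n)| ≤
          KB * A.size x / Real.log x ^ 5) :
    ∃ K : ℝ, ∀ᶠ x : ℝ in atTop, ∀ s : ℝ, IsFISplit D α θ x s →
      ∀ z : ℝ, fiY D θ x ≤ z → z ≤ Real.exp 1 * fiY D θ x →
        |A.fiS2Y (lam x) s x (fiY D θ x) z| ≤ K * A.size x / Real.log x := by
  classical
  have h116 : ∀ n : ℕ, ¬Squarefree n → A.a n = 0 := hhyp.2.2.2.2.2.1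
  obtain ⟨KB, hKB⟩ := hKBex
  obtain ⟨K₆, h16c⟩ := hhyp.2.2.1
  have hθ : 0 < θ := by linarith [hθ₁pos, hθ₁le]
  have hθ6 : θ < 1 / 6 := hθlt
  have hθ3 : θ < 1 / 3 := by linarith
  have hα : 0 < α := hαpos
  set K₀ := max KB 0 with hK₀
  have hK₀0 : 0 ≤ K₀ := le_max_right _ _
  have hKBK₀ : KB ≤ K₀ := le_max_left _ _
  set C6 : ℝ := 2 ^ 18 * max K₆ 0 * Real.exp (2 ^ 28) with hC6
  have hC60 : 0 ≤ C6 := by positivity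
  refine ⟨12 * K₀ + 2 * C6, ?_⟩
  have hR1 : ∀ᶠ x : ℝ in atTop, x ^ (2 / 3 : ℝ) < D x ∧ D x < x :=
    hhyp.2.2.2.2.2.2.1.mono fun x hx => ⟨hx.1, hx.2.1⟩
  have hllev : ∀ᶠ x : ℝ in atTop, 0 < Real.log (Real.log x) :=
    ((Real.tendsto_log_atTop.comp Real.tendsto_log_atTop).eventually_gt_atTop 0).mono fun x hx => hx
  filter_upwards [hweights, hKB, hR1, eventually_ge_atTop (Real.exp 1), h16c, hparams, hllev,
    eventually_ge_atTop (16 : ℝ)] with x hw hBx hR1x hxe h16x hparx hll hx16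
  intro s hs z _hYz _hzY
  -- basics at `x`
  have he1 : (1 : ℝ) ≤ Real.exp 1 := by linarith [Real.add_one_le_exp (1 : ℝ)]
  have hx1 : 1 ≤ x := he1.trans hxe
  have hx1' : 1 < x := by linarith only [hx16]
  have hx0 : 0 < x := by linarith
  have hlogx : 1 ≤ Real.log x := by rw [Real.le_log_iff_exp_le hx0]; exact hxe
  have hlogx0 : 0 < Real.log x := by linarith
  have hD1 : 1 ≤ D x := le_trans (Real.one_le_rpow hx1 (by norm_num)) hR1x.1.le
  have hD0 : 0 < D x := by linarith
  have hDx : D x < x := hR1x.2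
  have hxD1 : (1 : ℝ) ≤ x / D x := (one_le_div hD0).mpr hDx.le
  have hA0 : 0 ≤ A.size x := by rw [hhyp.size_eq]; exact A.congrSum_nonneg 1 x
  set L := x ^ (θ / 2) with hLdef
  have hL1 : 1 ≤ L := Real.one_le_rpow hx1 (by linarith)
  have hL0 : 0 < L := by linarith
  have hLx : L ≤ x := by
    calc L = x ^ (θ / 2) := rfl
      _ ≤ x ^ (1 : ℝ) := Real.rpow_le_rpow_of_exponent_le hx1 (by linarith)
      _ = x := Real.rpow_one x
  have hxθ0 : x ^ (θ / 2) ≠ 0 := hL0.ne'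
  have hsD0 : Real.sqrt (D x) ≠ 0 := (Real.sqrt_pos.mpr hD0).ne'
  have hlα1 : 1 ≤ Real.log x ^ α := Real.one_le_rpow hlogx hα.le
  have hlα0 : Real.log x ^ α ≠ 0 := by positivity
  set Y := fiY D θ x with hYdef
  obtain ⟨hY0, -⟩ :=
    fiY_pos_and_ge (D := D) (θ := θ) (θ₁ := 1 / 3 - θ / 2) hx1 hR1x.1 le_rfl
  have hYe : Y ≤ Real.exp 1 * Y := le_mul_of_one_le_left hY0.le he1
  have hYL0 : 0 < Y / L := div_pos hY0 hL0
  have hYLe : Y / L ≤ Real.exp 1 * Y := (div_le_self hY0.le hL1).trans hYe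
  have hYL_eq : Y / L = Real.sqrt (D x) / x ^ θ := by
    show fiY D θ x / x ^ (θ / 2) = Real.sqrt (D x) / x ^ θ
    rw [fiY, div_div, ← Real.rpow_add hx0, add_halves]
  have hSY : fiSLow D α θ x * Y = Real.sqrt x / (8 * Real.log x ^ α) := by
    show fiSLow D α θ x * fiY D θ x = Real.sqrt x / (8 * Real.log x ^ α)
    have hb : 8 * Real.log x ^ α * Real.sqrt (D x) * x ^ (θ / 2) ≠ 0 :=
      mul_ne_zero (mul_ne_zero (mul_ne_zero (by norm_num) hlα0) hsD0) hxθ0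
    have hd : (8 * Real.log x ^ α) ≠ 0 := mul_ne_zero (by norm_num) hlα0
    rw [fiSLow, fiY, div_mul_div_comm, div_eq_div_iff hb hd]
    ring
  have hfiSLow_le : fiSLow D α θ x ≤ x ^ 2 / 8 := by
    unfold fiSLow
    rw [div_le_div_iff₀ (by positivity) (by norm_num : (0 : ℝ) < 8)]
    have h2 : Real.sqrt x ≤ x := Real.sqrt_le_self_iff.mpr (Or.inr hx1)
    have h4 : 1 ≤ Real.sqrt (D x) := Real.one_le_sqrt.mpr hD1
    have hsx0 : 0 ≤ Real.sqrt x := Real.sqrt_nonneg x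
    calc x ^ (θ / 2) * Real.sqrt x * 8 ≤ x * x * (8 * 1 * 1) := by
          nlinarith [mul_le_mul hLx h2 hsx0 hx0.le]
      _ ≤ x ^ 2 * (8 * Real.log x ^ α * Real.sqrt (D x)) := by
          rw [sq]
          gcongr
  -- the splitting parameter `s = 2^{k₀}`
  obtain ⟨⟨k₀, rfl⟩, _hslow, hsup⟩ := hs
  have hk₀ : (k₀ : ℝ) ≤ 4 * Real.log x := by
    refine nat_le_four_mul_log_of_two_pow_le ?_
    nlinarith [hsup, hfiSLow_le]
  set X := ⌊x⌋₊ with hXdef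
  -- the inner sums `Ψ(ℓ, u) = ∑_{b ≤ X/ℓ, u < b ≤ su} μ(b) a_{bℓ}`
  set Ψ : ℕ → ℝ → ℝ := fun ℓ u => ∑ b ∈ Icc 1 (X / ℓ),
      (if u < (b : ℝ) ∧ (b : ℝ) ≤ 2 ^ k₀ * u then (μ b : ℝ) * A.a (b * ℓ) else 0) with hΨdef
  have hΨm : ∀ ℓ, Measurable (Ψ ℓ) := fun ℓ => A.measurable_innerS2 X ℓ (2 ^ k₀)
  have hΨb : ∀ ℓ u, |Ψ ℓ u| ≤ ∑ b ∈ Icc 1 (X / ℓ), A.a (b * ℓ) := fun ℓ u =>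
    A.abs_innerS2_le X ℓ (2 ^ k₀) u
  have hΨam : ∀ ℓ, Measurable fun u => |Ψ ℓ u| := fun ℓ => continuous_abs.measurable.comp (hΨm ℓ)
  have hΨab : ∀ ℓ u, |(fun u => |Ψ ℓ u|) u| ≤ ∑ b ∈ Icc 1 (X / ℓ), A.a (b * ℓ) := fun ℓ u => by
    simpa only [abs_abs] using hΨb ℓ u
  have hJX : ∀ ℓ, X < ℓ → ∀ u, |Ψ ℓ u| = 0 := by
    intro ℓ hℓ u
    have hI : Icc 1 (X / ℓ) = ∅ := by
      rw [Nat.div_eq_of_lt hℓ]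
      exact Finset.Icc_eq_empty_of_lt zero_lt_one
    simp only [hΨdef, hI, Finset.sum_empty, abs_zero]
  -- integrability of the pieces
  have hpiece : ∀ (ℓ : ℕ) (ν : ℝ) {a b : ℝ}, 0 < a → a ≤ b →
      IntervalIntegrable (fun y => |Ψ ℓ (y / ν)| / y) volume a b := fun ℓ ν a b ha hab =>
    intervalIntegrable_comp_div_div (h := fun u => |Ψ ℓ u|) (hΨam ℓ) (hΨab ℓ) ν ha hab
  have hpiece1 : ∀ (ℓ : ℕ) {a b : ℝ}, 0 < a → a ≤ b →
      IntervalIntegrable (fun u => |Ψ ℓ u| / u) volume a b := fun ℓ a b ha hab => by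
    simpa only [div_one] using hpiece ℓ 1 ha hab
  -- the weights `c_k = (log x) τ(k)` and the constants
  set c : ℕ → ℝ := fun k => Real.log x * (k.divisors.card : ℝ) with hcdef
  have hc0 : ∀ k, 0 ≤ c k := fun k => mul_nonneg hlogx0.le (Nat.cast_nonneg _)
  set KB' : ℝ := K₀ * A.size x / Real.log x ^ 5 with hKB'
  have hKB'0 : 0 ≤ KB' := by positivity
  set M₀ : ℝ := k₀ * KB' with hM₀
  -- the reduced sieved bilinear bound on the dyadic pieces, for `v ∈ (Y/Δ², eY)`, `C = 1`
  have hYLL0 : 0 < Y / L / L := div_pos hYL0 hL0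
  have hB6' : ∀ v ∈ Set.Ioo (Y / L / L) (Real.exp 1 * Y), ∀ i ∈ range k₀,
      ∑ m ∈ Icc 1 ⌊x⌋₊, (6 : ℝ) ^ m.primeFactors.card *
        |∑ n ∈ (Ioc ⌊2 ^ i * v⌋₊ ⌊2 * (2 ^ i * v)⌋₊).filter
            (fun n : ℕ => ((m * n : ℕ) : ℝ) ≤ x ∧ ∀ p ∈ n.primeFactors, P x ≤ (p : ℝ)),
          (SieveSequence.fiGamma 1 n : ℝ) * (μ (m * n) : ℝ) * A.a (m * n)| ≤ KB' := by
    intro v hv i hi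
    have hi' : i < k₀ := Finset.mem_range.mp hi
    have hv0 : 0 < v := hYLL0.trans hv.1
    have hN1 : Real.sqrt (D x) / x ^ (2 * θ) < 2 ^ i * v := by
      have hle : Real.sqrt (D x) / x ^ (2 * θ) ≤ Y / L / L := by
        rw [hYL_eq, div_div, ← Real.rpow_add hx0]
        refine div_le_div_of_nonneg_left (Real.sqrt_nonneg _) (Real.rpow_pos_of_pos hx0 _) ?_
        exact Real.rpow_le_rpow_of_exponent_le hx1 (by linarith only [hθ])
      calc Real.sqrt (D x) / x ^ (2 * θ) ≤ Y / L / L := hle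
        _ < v := hv.1
        _ ≤ 2 ^ i * v := le_mul_of_one_le_left hv0.le (one_le_pow₀ one_le_two)
    have h2i : (2 : ℝ) ^ i ≤ 2 ^ k₀ / 2 := by
      rw [le_div_iff₀ two_pos, ← pow_succ]
      exact pow_le_pow_right₀ one_le_two (Nat.succ_le_of_lt hi')
    have hq : 0 < Real.sqrt x / Real.log x ^ α := div_pos (Real.sqrt_pos.mpr hx0) (by positivity)
    have he8 : Real.exp 1 / 8 < 1 := by have := Real.exp_one_lt_d9; linarith
    have hN2 : 2 ^ i * v < Real.sqrt x / Real.log x ^ α := by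
      calc 2 ^ i * v ≤ 2 ^ i * (Real.exp 1 * Y) := mul_le_mul_of_nonneg_left hv.2.le (by positivity)
        _ ≤ (2 ^ k₀ / 2) * (Real.exp 1 * Y) := mul_le_mul_of_nonneg_right h2i (by positivity)
        _ ≤ fiSLow D α θ x * (Real.exp 1 * Y) :=
            mul_le_mul_of_nonneg_right (by linarith [hsup]) (by positivity)
        _ = (Real.exp 1 / 8) * (Real.sqrt x / Real.log x ^ α) := by
            rw [show fiSLow D α θ x * (Real.exp 1 * Y) = Real.exp 1 * (fiSLow D α θ x * Y) by ring,
              hSY]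
            field_simp
        _ < 1 * (Real.sqrt x / Real.log x ^ α) := mul_lt_mul_of_pos_right he8 hq
        _ = Real.sqrt x / Real.log x ^ α := one_mul _
    have h0 := hBx (2 ^ i * v) hN1 hN2 1 le_rfl hxD1
    refine h0.trans ?_
    rw [hKB']
    exact div_le_div_of_nonneg_right (mul_le_mul_of_nonneg_right hKBK₀ hA0) (by positivity)
  -- `W₁` (Rankin under (10.2) and the sixth moment): the constant `E6`
  have hPx1 : 1 < P x := by linarith only [hparx.2.2.1]
  set M6 : ℝ := ∑ n ∈ Ioc 0 ⌊x⌋₊, A.a n * ((n.divisors.card : ℝ)) ^ 6 with hM6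
  have hM60 : 0 ≤ M6 := Finset.sum_nonneg fun n _ => mul_nonneg (A.a_nonneg n) (by positivity)
  set E6 : ℝ := L ^ (-(1 / Real.log (P x))) * M6 with hE6
  have hrank0 : 0 ≤ L ^ (-(1 / Real.log (P x))) := Real.rpow_nonneg hL0.le _
  have hE60 : 0 ≤ E6 := mul_nonneg hrank0 hM60
  have hE6le : E6 ≤ C6 * A.size x / Real.log x ^ 7 := by
    have hx8 : (8 : ℝ) ≤ x := by linarith only [hx16]
    have hmom := hhyp.sum_a_mul_card_divisors_pow_six_le hx8 h16x
    have hrank : L ^ (-(1 / Real.log (P x))) ≤ Real.log x ^ (-(2 ^ 33 : ℝ)) := by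
      rw [hLdef]; exact rankin_rpow_le_log_rpow hx1' hll hθ hparx.2.2.1 hparx.2.2.2
    have hpow : Real.log x ^ (-(2 ^ 33 : ℝ)) * Real.log x ^ (2 ^ 26 : ℝ) ≤ (Real.log x ^ 7)⁻¹ := by
      have h7 : (Real.log x ^ 7)⁻¹ = Real.log x ^ (-(7 : ℝ)) := by
        rw [Real.rpow_neg hlogx0.le, show (7 : ℝ) = ((7 : ℕ) : ℝ) by norm_num, Real.rpow_natCast]
      rw [h7, ← Real.rpow_add hlogx0]
      exact Real.rpow_le_rpow_of_exponent_le hlogx (by norm_num)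
    calc E6 ≤ Real.log x ^ (-(2 ^ 33 : ℝ)) * (C6 * A.size x * Real.log x ^ (2 ^ 26 : ℝ)) :=
          mul_le_mul hrank hmom hM60 (Real.rpow_nonneg hlogx0.le _)
      _ = C6 * A.size x * (Real.log x ^ (-(2 ^ 33 : ℝ)) * Real.log x ^ (2 ^ 26 : ℝ)) := by ring
      _ ≤ C6 * A.size x * (Real.log x ^ 7)⁻¹ := mul_le_mul_of_nonneg_left hpow (by positivity)
      _ = C6 * A.size x / Real.log x ^ 7 := by rw [div_eq_mul_inv]
  -- Step (A): `|∫ S₂ dy/y| ≤ ∫ G dy`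
  set G : ℝ → ℝ := fun y => ∑ k ∈ Icc 1 X, ∑ ν ∈ Icc 1 ⌊L⌋₊, c k * (|Ψ (ν * k) (y / ν)| / y)
    with hGdef
  have hGalt : ∀ y, G y = (Real.log x * ∑ k ∈ Icc 1 X, (k.divisors.card : ℝ) *
      ∑ ν ∈ Icc 1 ⌊L⌋₊, |Ψ (ν * k) (y / ν)|) / y := by
    intro y
    simp only [hGdef, hcdef]
    rw [Finset.mul_sum, Finset.sum_div]
    refine Finset.sum_congr rfl fun k _ => ?_
    rw [Finset.mul_sum, Finset.mul_sum, Finset.sum_div]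
    refine Finset.sum_congr rfl fun ν _ => ?_
    ring
  have hGint : IntervalIntegrable G volume Y (Real.exp 1 * Y) := by
    refine intervalIntegrable_finset_sum_fun _ fun k _ => ?_
    refine intervalIntegrable_finset_sum_fun _ fun ν _ => ?_
    exact (hpiece (ν * k) ν hY0 hYe).const_mul _
  have hpt : ∀ᵐ y : ℝ, y ∈ Set.Ioc Y (Real.exp 1 * Y) →
      ‖A.fiS2 (lam x) (2 ^ k₀) x y z / y‖ ≤ G y := by
    refine Filter.Eventually.of_forall fun y hy => ?_
    have hy0 : 0 < y := hY0.trans hy.1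
    rw [Real.norm_eq_abs, abs_div, abs_of_pos hy0, hGalt y]
    refine div_le_div_of_nonneg_right ?_ hy0.le
    exact A.abs_fiS2_le h116 hw hL0.le hx1 (2 ^ k₀) y z
  have hA : |A.fiS2Y (lam x) (2 ^ k₀) x Y z| ≤ ∫ y in Y..(Real.exp 1 * Y), G y := by
    have h := intervalIntegral.norm_integral_le_of_norm_le
      (f := fun y => A.fiS2 (lam x) (2 ^ k₀) x y z / y) hYe hpt hGint
    rw [Real.norm_eq_abs] at h
    simpa only [SieveSequence.fiS2Y, SieveSequence.logAvg] using h
  -- Step (B): push the integral through the finite sums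
  have hBeq : ∫ y in Y..(Real.exp 1 * Y), G y =
      ∑ k ∈ Icc 1 X, ∑ ν ∈ Icc 1 ⌊L⌋₊, c k * ∫ y in Y..(Real.exp 1 * Y), |Ψ (ν * k) (y / ν)| / y := by
    simp only [hGdef]
    rw [intervalIntegral.integral_finsetSum (fun k _ =>
      intervalIntegrable_finset_sum_fun _ fun ν _ => (hpiece (ν * k) ν hY0 hYe).const_mul _)]
    refine Finset.sum_congr rfl fun k _ => ?_
    rw [intervalIntegral.integral_finsetSum (fun ν _ => (hpiece (ν * k) ν hY0 hYe).const_mul _)]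
    refine Finset.sum_congr rfl fun ν _ => ?_
    exact intervalIntegral.integral_const_mul _ _
  -- Step (C): the change of variables `u = y/ν₂`, `1 ≤ ν₂ ≤ Δ`
  have hCle : (∑ k ∈ Icc 1 X, ∑ ν ∈ Icc 1 ⌊L⌋₊,
        c k * ∫ y in Y..(Real.exp 1 * Y), |Ψ (ν * k) (y / ν)| / y) ≤
      ∑ k ∈ Icc 1 X, ∑ ν ∈ Icc 1 ⌊L⌋₊,
        c k * ∫ u in (Y / L)..(Real.exp 1 * Y), |Ψ (ν * k) u| / u := by
    refine Finset.sum_le_sum fun k _ => Finset.sum_le_sum fun ν hν => ?_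
    refine mul_le_mul_of_nonneg_left ?_ (hc0 k)
    obtain ⟨hν1, hνL⟩ := Finset.mem_Icc.mp hν
    exact intervalIntegral_comp_div_le (h := fun u => |Ψ (ν * k) u|) (hΨam _)
      (fun u => abs_nonneg _) (fun u => hΨb _ u) hY0 (by exact_mod_cast hν1)
      ((Nat.cast_le.mpr hνL).trans (Nat.floor_le hL0.le))
  -- Step (D): pull the finite sums back inside
  have hDeq : (∑ k ∈ Icc 1 X, ∑ ν ∈ Icc 1 ⌊L⌋₊,
        c k * ∫ u in (Y / L)..(Real.exp 1 * Y), |Ψ (ν * k) u| / u) =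
      ∫ u in (Y / L)..(Real.exp 1 * Y),
        ∑ k ∈ Icc 1 X, ∑ ν ∈ Icc 1 ⌊L⌋₊, c k * (|Ψ (ν * k) u| / u) := by
    rw [intervalIntegral.integral_finsetSum (fun k _ =>
      intervalIntegrable_finset_sum_fun _ fun ν _ => (hpiece1 (ν * k) hYL0 hYLe).const_mul _)]
    refine Finset.sum_congr rfl fun k _ => ?_
    rw [intervalIntegral.integral_finsetSum (fun ν _ => (hpiece1 (ν * k) hYL0 hYLe).const_mul _)]
    refine Finset.sum_congr rfl fun ν _ => ?_
    exact (intervalIntegral.integral_const_mul _ _).symm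
  -- Step (E): the pointwise bound by `τ₃`, then §10: `W₀(u) + W₁`
  set SMle : ℕ → Finset ℕ := fun ℓ => (Icc 1 (X / ℓ)).filter (fun n : ℕ => Squarefree n ∧
      (∀ p ∈ n.primeFactors, (p : ℝ) < P x) ∧ (n : ℝ) ≤ L) with hSMle
  set Ψs : ℕ → ℝ → ℝ := fun ℓ' v => ∑ n₀ ∈ (Icc 1 (X / ℓ')).filter
      (fun n : ℕ => ∀ p ∈ n.primeFactors, P x ≤ (p : ℝ)),
        (if v < (n₀ : ℝ) ∧ (n₀ : ℝ) ≤ 2 ^ k₀ * v then (μ n₀ : ℝ) * A.a (n₀ * ℓ') else 0) with hΨs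
  set F0 : ℝ → ℝ := fun u => ∑ ℓ ∈ Icc 1 X, (divisorCountK 3 ℓ : ℝ) *
      ∑ n₁ ∈ SMle ℓ, |Ψs (ℓ * n₁) (u / n₁)| with hF0
  have hF00 : ∀ u, 0 ≤ F0 u := fun u => Finset.sum_nonneg fun ℓ _ =>
    mul_nonneg (Nat.cast_nonneg _) (Finset.sum_nonneg fun n₁ _ => abs_nonneg _)
  have hpt2 : ∀ u ∈ Set.Ioo (Y / L) (Real.exp 1 * Y),
      (∑ k ∈ Icc 1 X, ∑ ν ∈ Icc 1 ⌊L⌋₊, c k * (|Ψ (ν * k) u| / u)) ≤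
        Real.log x * ((F0 u + E6) * u⁻¹) := by
    intro u hu
    have hu0 : 0 < u := hYL0.trans hu.1
    have hsum1 : (∑ k ∈ Icc 1 X, (k.divisors.card : ℝ) * ∑ ν ∈ Icc 1 ⌊L⌋₊, |Ψ (ν * k) u|) ≤
        ∑ ℓ ∈ Icc 1 X, (divisorCountK 3 ℓ : ℝ) * |Ψ ℓ u| :=
      sum_card_divisors_mul_sum_le (J := fun ℓ => |Ψ ℓ u|) (fun ℓ => abs_nonneg _)
        (fun ℓ hℓ => hJX ℓ hℓ u) ⌊L⌋₊
    have hsum2 : ∑ ℓ ∈ Icc 1 X, (divisorCountK 3 ℓ : ℝ) * |Ψ ℓ u| ≤ F0 u + E6 := by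
      calc ∑ ℓ ∈ Icc 1 X, (divisorCountK 3 ℓ : ℝ) * |Ψ ℓ u|
          ≤ ∑ ℓ ∈ Icc 1 X, (divisorCountK 3 ℓ : ℝ) * ((∑ n₁ ∈ SMle ℓ, |Ψs (ℓ * n₁) (u / n₁)|) +
              L ^ (-(1 / Real.log (P x))) * ∑ b ∈ Icc 1 (X / ℓ), ((b.divisors.card : ℝ)) ^ 2 * A.a (b * ℓ)) := by
            refine Finset.sum_le_sum fun ℓ _ => mul_le_mul_of_nonneg_left ?_ (Nat.cast_nonneg _)
            exact (abs_Psi_le_smooth_add_large (A := A) (P x) L ℓ X u (2 ^ k₀)).trans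
              (add_le_add le_rfl (sum_large_smooth_le_rankin_one h116 hPx1 hL0 ℓ X))
        _ = F0 u + L ^ (-(1 / Real.log (P x))) * ∑ ℓ ∈ Icc 1 X, (divisorCountK 3 ℓ : ℝ) *
              ∑ b ∈ Icc 1 (X / ℓ), ((b.divisors.card : ℝ)) ^ 2 * A.a (b * ℓ) := by
            rw [hF0, Finset.mul_sum, ← Finset.sum_add_distrib]
            exact Finset.sum_congr rfl fun ℓ _ => by ring
        _ ≤ F0 u + E6 := add_le_add le_rfl (mul_le_mul_of_nonneg_left (sum_tau3_sum_tau_sq_le X) hrank0)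
    have heq : (∑ k ∈ Icc 1 X, ∑ ν ∈ Icc 1 ⌊L⌋₊, c k * (|Ψ (ν * k) u| / u)) =
        (Real.log x * u⁻¹) *
          ∑ k ∈ Icc 1 X, (k.divisors.card : ℝ) * ∑ ν ∈ Icc 1 ⌊L⌋₊, |Ψ (ν * k) u| := by
      rw [Finset.mul_sum]
      refine Finset.sum_congr rfl fun k _ => ?_
      rw [Finset.mul_sum, Finset.mul_sum]
      refine Finset.sum_congr rfl fun ν _ => ?_
      simp only [hcdef]
      rw [div_eq_mul_inv]
      ring
    rw [heq]
    calc Real.log x * u⁻¹ *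
          ∑ k ∈ Icc 1 X, (k.divisors.card : ℝ) * ∑ ν ∈ Icc 1 ⌊L⌋₊, |Ψ (ν * k) u|
        ≤ Real.log x * u⁻¹ * (F0 u + E6) :=
          mul_le_mul_of_nonneg_left (hsum1.trans hsum2) (by positivity)
      _ = Real.log x * ((F0 u + E6) * u⁻¹) := by ring
  -- the integrated `W₀`: `∫_{Y/L}^{eY} F0(u) du/u ≤ k₀ KB' (1 + 2 log L)`
  have hΨsm : ∀ ℓ', Measurable (Ψs ℓ') := fun ℓ' =>
    measurable_window_sum _ (fun n₀ => (μ n₀ : ℝ) * A.a (n₀ * ℓ')) (2 ^ k₀)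
  have hΨsam : ∀ ℓ', Measurable fun v => |Ψs ℓ' v| := fun ℓ' => continuous_abs.measurable.comp (hΨsm ℓ')
  have hΨsb : ∀ ℓ' v, |Ψs ℓ' v| ≤ ∑ n₀ ∈ (Icc 1 (X / ℓ')).filter
      (fun n : ℕ => ∀ p ∈ n.primeFactors, P x ≤ (p : ℝ)), |(μ n₀ : ℝ) * A.a (n₀ * ℓ')| := fun ℓ' v =>
    abs_window_sum_le _ (fun n₀ => (μ n₀ : ℝ) * A.a (n₀ * ℓ')) (2 ^ k₀) v
  have hΨsab : ∀ ℓ' v, |(fun v => |Ψs ℓ' v|) v| ≤ ∑ n₀ ∈ (Icc 1 (X / ℓ')).filter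
      (fun n : ℕ => ∀ p ∈ n.primeFactors, P x ≤ (p : ℝ)), |(μ n₀ : ℝ) * A.a (n₀ * ℓ')| := fun ℓ' v => by
    simpa only [abs_abs] using hΨsb ℓ' v
  have hΨsq : ∀ ℓ', ¬Squarefree ℓ' → ∀ v, Ψs ℓ' v = 0 := by
    intro ℓ' hℓ' v
    refine Finset.sum_eq_zero fun n₀ _ => ?_
    have : ¬Squarefree (n₀ * ℓ') := fun h => hℓ' (Squarefree.of_mul_right h)
    rw [h116 _ this, mul_zero, ite_self]
  have hspiece : ∀ (ℓ' : ℕ) (ν : ℝ) {a b : ℝ}, 0 < a → a ≤ b →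
      IntervalIntegrable (fun y => |Ψs ℓ' (y / ν)| / y) volume a b := fun ℓ' ν a b ha hab =>
    intervalIntegrable_comp_div_div (h := fun v => |Ψs ℓ' v|) (hΨsam ℓ') (hΨsab ℓ') ν ha hab
  have hspiece1 : ∀ (ℓ' : ℕ) {a b : ℝ}, 0 < a → a ≤ b →
      IntervalIntegrable (fun v => |Ψs ℓ' v| / v) volume a b := fun ℓ' a b ha hab => by
    simpa only [div_one] using hspiece ℓ' 1 ha hab
  have hF0int : IntervalIntegrable (fun u => F0 u / u) volume (Y / L) (Real.exp 1 * Y) := by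
    have hfun : (fun u => F0 u / u) = fun u => ∑ ℓ ∈ Icc 1 X, ∑ n₁ ∈ SMle ℓ,
        (divisorCountK 3 ℓ : ℝ) * (|Ψs (ℓ * n₁) (u / n₁)| / u) := by
      funext u
      rw [hF0]
      dsimp only
      rw [Finset.sum_div]
      refine Finset.sum_congr rfl fun ℓ _ => ?_
      rw [Finset.mul_sum, Finset.sum_div]
      exact Finset.sum_congr rfl fun n₁ _ => by ring
    rw [hfun]
    exact intervalIntegrable_finset_sum_fun _ fun ℓ _ =>
      intervalIntegrable_finset_sum_fun _ fun n₁ _ => (hspiece (ℓ * n₁) n₁ hYL0 hYLe).const_mul _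
  have hYLLe : Y / L / L ≤ Real.exp 1 * Y := (div_le_self hYL0.le hL1).trans hYLe
  have hW0 : ∫ u in (Y / L)..(Real.exp 1 * Y), F0 u / u ≤ (k₀ * KB') * (1 + 2 * Real.log L) := by
    -- push the integral inside and change variables `v = u/n₁`
    set I : ℕ → ℝ := fun ℓ' => ∫ v in (Y / L / L)..(Real.exp 1 * Y), |Ψs ℓ' v| / v with hI
    have hI0 : ∀ ℓ', 0 ≤ I ℓ' := fun ℓ' =>
      intervalIntegral.integral_nonneg hYLLe fun v hv => div_nonneg (abs_nonneg _) (hYLL0.le.trans hv.1)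
    have hIsq : ∀ ℓ', ¬Squarefree ℓ' → I ℓ' = 0 := by
      intro ℓ' hℓ'
      rw [hI]
      dsimp only
      simp_rw [hΨsq ℓ' hℓ', abs_zero, zero_div]
      exact intervalIntegral.integral_zero
    have h1 : ∫ u in (Y / L)..(Real.exp 1 * Y), F0 u / u =
        ∑ ℓ ∈ Icc 1 X, ∑ n₁ ∈ SMle ℓ, (divisorCountK 3 ℓ : ℝ) *
          ∫ u in (Y / L)..(Real.exp 1 * Y), |Ψs (ℓ * n₁) (u / n₁)| / u := by
      have hfun : (fun u => F0 u / u) = fun u => ∑ ℓ ∈ Icc 1 X, ∑ n₁ ∈ SMle ℓ,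
          (divisorCountK 3 ℓ : ℝ) * (|Ψs (ℓ * n₁) (u / n₁)| / u) := by
        funext u
        rw [hF0]
        dsimp only
        rw [Finset.sum_div]
        refine Finset.sum_congr rfl fun ℓ _ => ?_
        rw [Finset.mul_sum, Finset.sum_div]
        exact Finset.sum_congr rfl fun n₁ _ => by ring
      rw [hfun, intervalIntegral.integral_finsetSum (fun ℓ _ =>
        intervalIntegrable_finset_sum_fun _ fun n₁ _ => (hspiece (ℓ * n₁) n₁ hYL0 hYLe).const_mul _)]
      refine Finset.sum_congr rfl fun ℓ _ => ?_
      rw [intervalIntegral.integral_finsetSum (fun n₁ _ => (hspiece (ℓ * n₁) n₁ hYL0 hYLe).const_mul _)]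
      refine Finset.sum_congr rfl fun n₁ _ => ?_
      exact intervalIntegral.integral_const_mul _ _
    have h2 : (∑ ℓ ∈ Icc 1 X, ∑ n₁ ∈ SMle ℓ, (divisorCountK 3 ℓ : ℝ) *
          ∫ u in (Y / L)..(Real.exp 1 * Y), |Ψs (ℓ * n₁) (u / n₁)| / u) ≤
        ∑ ℓ ∈ Icc 1 X, (divisorCountK 3 ℓ : ℝ) * ∑ n₁ ∈ SMle ℓ, I (ℓ * n₁) := by
      refine Finset.sum_le_sum fun ℓ _ => ?_
      rw [Finset.mul_sum]
      refine Finset.sum_le_sum fun n₁ hn₁ => mul_le_mul_of_nonneg_left ?_ (Nat.cast_nonneg _)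
      obtain ⟨hI1, -, -, hνL⟩ := Finset.mem_filter.mp hn₁
      exact intervalIntegral_comp_div_le_gen (h := fun v => |Ψs (ℓ * n₁) v|) (hΨsam _)
        (fun v => abs_nonneg _) (fun v => hΨsb _ v) hYL0 hYLe (by exact_mod_cast (Finset.mem_Icc.mp hI1).1) hνL
    have h3 : ∑ ℓ ∈ Icc 1 X, (divisorCountK 3 ℓ : ℝ) * ∑ n₁ ∈ SMle ℓ, I (ℓ * n₁) ≤
        ∑ ℓ' ∈ Icc 1 X, (6 : ℝ) ^ ℓ'.primeFactors.card * I ℓ' :=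
      sum_tau3_sum_mul_le hI0 hIsq X _
    have h4 : ∑ ℓ' ∈ Icc 1 X, (6 : ℝ) ^ ℓ'.primeFactors.card * I ℓ' ≤ (k₀ * KB') * (1 + 2 * Real.log L) := by
      have h41 : ∑ ℓ' ∈ Icc 1 X, (6 : ℝ) ^ ℓ'.primeFactors.card * I ℓ' =
          ∫ v in (Y / L / L)..(Real.exp 1 * Y), ∑ ℓ' ∈ Icc 1 X,
            (6 : ℝ) ^ ℓ'.primeFactors.card * (|Ψs ℓ' v| / v) := by
        rw [intervalIntegral.integral_finsetSum (fun ℓ' _ => (hspiece1 ℓ' hYLL0 hYLLe).const_mul _)]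
        refine Finset.sum_congr rfl fun ℓ' _ => ?_
        rw [hI]
        exact (intervalIntegral.integral_const_mul _ _).symm
      rw [h41]
      have hpt : ∀ v ∈ Set.Ioo (Y / L / L) (Real.exp 1 * Y),
          (∑ ℓ' ∈ Icc 1 X, (6 : ℝ) ^ ℓ'.primeFactors.card * (|Ψs ℓ' v| / v)) ≤ (k₀ * KB') * v⁻¹ := by
        intro v hv
        have hv0 : 0 < v := hYLL0.trans hv.1
        have hsum : ∑ ℓ' ∈ Icc 1 X, (6 : ℝ) ^ ℓ'.primeFactors.card * |Ψs ℓ' v| ≤ k₀ * KB' :=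
          sum_six_pow_abs_rough_innerS2_le h116 (P x) hx0.le hv0.le k₀ (fun i hi => hB6' v hv i hi)
        have heq : (∑ ℓ' ∈ Icc 1 X, (6 : ℝ) ^ ℓ'.primeFactors.card * (|Ψs ℓ' v| / v)) =
            v⁻¹ * ∑ ℓ' ∈ Icc 1 X, (6 : ℝ) ^ ℓ'.primeFactors.card * |Ψs ℓ' v| := by
          rw [Finset.mul_sum]
          exact Finset.sum_congr rfl fun ℓ' _ => by rw [div_eq_mul_inv]; ring
        rw [heq]
        calc v⁻¹ * ∑ ℓ' ∈ Icc 1 X, (6 : ℝ) ^ ℓ'.primeFactors.card * |Ψs ℓ' v| ≤ v⁻¹ * (k₀ * KB') :=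
              mul_le_mul_of_nonneg_left hsum (inv_nonneg.mpr hv0.le)
          _ = (k₀ * KB') * v⁻¹ := mul_comm _ _
      have hinv' : IntervalIntegrable (fun v : ℝ => (k₀ * KB') * v⁻¹) volume (Y / L / L) (Real.exp 1 * Y) := by
        refine (intervalIntegral.intervalIntegrable_inv (fun v hv => ?_) continuousOn_id).const_mul _
        rw [Set.uIcc_of_le hYLLe] at hv
        exact (hYLL0.trans_le hv.1).ne'
      have hle : (∫ v in (Y / L / L)..(Real.exp 1 * Y), ∑ ℓ' ∈ Icc 1 X,
            (6 : ℝ) ^ ℓ'.primeFactors.card * (|Ψs ℓ' v| / v)) ≤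
          ∫ v in (Y / L / L)..(Real.exp 1 * Y), (k₀ * KB') * v⁻¹ := by
        refine intervalIntegral.integral_mono_on_of_le_Ioo hYLLe ?_ hinv' hpt
        exact intervalIntegrable_finset_sum_fun _ fun ℓ' _ => (hspiece1 ℓ' hYLL0 hYLLe).const_mul _
      have hval : (∫ v in (Y / L / L)..(Real.exp 1 * Y), (k₀ * KB') * v⁻¹) = (k₀ * KB') * (1 + 2 * Real.log L) := by
        rw [intervalIntegral.integral_const_mul, integral_inv (Set.notMem_uIcc_of_lt hYLL0 (by positivity))]
        congr 1
        have : Real.exp 1 * Y / (Y / L / L) = Real.exp 1 * (L * L) := by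
          field_simp
          rw [div_self hY0.ne']
        rw [this, Real.log_mul (Real.exp_pos 1).ne' (by positivity), Real.log_exp,
          Real.log_mul hL0.ne' hL0.ne']
        ring
      exact hle.trans (le_of_eq hval)
    calc ∫ u in (Y / L)..(Real.exp 1 * Y), F0 u / u
        = ∑ ℓ ∈ Icc 1 X, ∑ n₁ ∈ SMle ℓ, (divisorCountK 3 ℓ : ℝ) *
            ∫ u in (Y / L)..(Real.exp 1 * Y), |Ψs (ℓ * n₁) (u / n₁)| / u := h1
      _ ≤ ∑ ℓ ∈ Icc 1 X, (divisorCountK 3 ℓ : ℝ) * ∑ n₁ ∈ SMle ℓ, I (ℓ * n₁) := h2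
      _ ≤ ∑ ℓ' ∈ Icc 1 X, (6 : ℝ) ^ ℓ'.primeFactors.card * I ℓ' := h3
      _ ≤ (k₀ * KB') * (1 + 2 * Real.log L) := h4
  -- integrate the pointwise bound
  have hinv : IntervalIntegrable (fun u : ℝ => E6 * u⁻¹) volume (Y / L) (Real.exp 1 * Y) := by
    refine (intervalIntegral.intervalIntegrable_inv (fun u hu => ?_) continuousOn_id).const_mul _
    rw [Set.uIcc_of_le hYLe] at hu
    exact (hYL0.trans_le hu.1).ne'
  have hrhsint : IntervalIntegrable (fun u => Real.log x * ((F0 u + E6) * u⁻¹)) volume (Y / L)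
      (Real.exp 1 * Y) := by
    have : (fun u => Real.log x * ((F0 u + E6) * u⁻¹)) = fun u => Real.log x * (F0 u / u + E6 * u⁻¹) := by
      funext u; ring
    rw [this]
    exact (hF0int.add hinv).const_mul _
  have hEle : (∫ u in (Y / L)..(Real.exp 1 * Y),
        ∑ k ∈ Icc 1 X, ∑ ν ∈ Icc 1 ⌊L⌋₊, c k * (|Ψ (ν * k) u| / u)) ≤
      ∫ u in (Y / L)..(Real.exp 1 * Y), Real.log x * ((F0 u + E6) * u⁻¹) := by
    refine intervalIntegral.integral_mono_on_of_le_Ioo hYLe ?_ hrhsint hpt2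
    exact intervalIntegrable_finset_sum_fun _ fun k _ =>
      intervalIntegrable_finset_sum_fun _ fun ν _ => (hpiece1 (ν * k) hYL0 hYLe).const_mul _
  have hEeq : (∫ u in (Y / L)..(Real.exp 1 * Y), Real.log x * ((F0 u + E6) * u⁻¹)) =
      Real.log x * ((∫ u in (Y / L)..(Real.exp 1 * Y), F0 u / u) + E6 * (1 + Real.log L)) := by
    have : (fun u => Real.log x * ((F0 u + E6) * u⁻¹)) = fun u => Real.log x * (F0 u / u + E6 * u⁻¹) := by
      funext u; ring
    rw [this, intervalIntegral.integral_const_mul, intervalIntegral.integral_add hF0int hinv,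
      intervalIntegral.integral_const_mul, integral_inv (Set.notMem_uIcc_of_lt hYL0 (by positivity))]
    congr 2
    congr 1
    have : Real.exp 1 * Y / (Y / L) = Real.exp 1 * L := by
      rw [div_div_eq_mul_div, mul_assoc, mul_comm Y L, ← mul_assoc, mul_div_assoc, div_self hY0.ne',
        mul_one]
    rw [this, Real.log_mul (Real.exp_pos 1).ne' hL0.ne', Real.log_exp]
  -- Step (F): numerics
  have hlogL : Real.log L ≤ Real.log x := Real.log_le_log hL0 hLx
  have hlogL0 : 0 ≤ Real.log L := Real.log_nonneg hL1
  have hF : Real.log x * ((∫ u in (Y / L)..(Real.exp 1 * Y), F0 u / u) + E6 * (1 + Real.log L)) ≤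
      (12 * K₀ + 2 * C6) * A.size x / Real.log x := by
    have h1 : (∫ u in (Y / L)..(Real.exp 1 * Y), F0 u / u) ≤ (4 * Real.log x * KB') * (3 * Real.log x) := by
      refine hW0.trans ?_
      exact mul_le_mul (mul_le_mul_of_nonneg_right hk₀ hKB'0) (by linarith) (by linarith) (by positivity)
    have h2 : E6 * (1 + Real.log L) ≤ (C6 * A.size x / Real.log x ^ 7) * (2 * Real.log x) :=
      mul_le_mul hE6le (by linarith) (by linarith) (by positivity)
    have h3 : Real.log x * ((4 * Real.log x * KB') * (3 * Real.log x)) = 12 * K₀ * A.size x / Real.log x ^ 2 := by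
      rw [hKB']; field_simp; ring
    have h4 : Real.log x * ((C6 * A.size x / Real.log x ^ 7) * (2 * Real.log x)) = 2 * C6 * A.size x / Real.log x ^ 5 := by
      field_simp
    have h5 : 12 * K₀ * A.size x / Real.log x ^ 2 ≤ 12 * K₀ * A.size x / Real.log x := by
      refine div_le_div_of_nonneg_left (by positivity) hlogx0 ?_
      calc Real.log x = Real.log x ^ 1 := (pow_one _).symm
        _ ≤ Real.log x ^ 2 := pow_le_pow_right₀ hlogx (by norm_num)
    have h6 : 2 * C6 * A.size x / Real.log x ^ 5 ≤ 2 * C6 * A.size x / Real.log x := by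
      refine div_le_div_of_nonneg_left (by positivity) hlogx0 ?_
      calc Real.log x = Real.log x ^ 1 := (pow_one _).symm
        _ ≤ Real.log x ^ 5 := pow_le_pow_right₀ hlogx (by norm_num)
    calc Real.log x * ((∫ u in (Y / L)..(Real.exp 1 * Y), F0 u / u) + E6 * (1 + Real.log L))
        ≤ Real.log x * ((4 * Real.log x * KB') * (3 * Real.log x) +
            (C6 * A.size x / Real.log x ^ 7) * (2 * Real.log x)) :=
          mul_le_mul_of_nonneg_left (add_le_add h1 h2) hlogx0.le
      _ = 12 * K₀ * A.size x / Real.log x ^ 2 + 2 * C6 * A.size x / Real.log x ^ 5 := by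
          rw [mul_add, h3, h4]
      _ ≤ 12 * K₀ * A.size x / Real.log x + 2 * C6 * A.size x / Real.log x := add_le_add h5 h6
      _ = (12 * K₀ + 2 * C6) * A.size x / Real.log x := by ring
  -- conclusion
  calc |A.fiS2Y (lam x) (2 ^ k₀) x Y z| ≤ ∫ y in Y..(Real.exp 1 * Y), G y := hA
    _ = ∑ k ∈ Icc 1 X, ∑ ν ∈ Icc 1 ⌊L⌋₊,
          c k * ∫ y in Y..(Real.exp 1 * Y), |Ψ (ν * k) (y / ν)| / y := hBeq
    _ ≤ ∑ k ∈ Icc 1 X, ∑ ν ∈ Icc 1 ⌊L⌋₊,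
          c k * ∫ u in (Y / L)..(Real.exp 1 * Y), |Ψ (ν * k) u| / u := hCle
    _ = ∫ u in (Y / L)..(Real.exp 1 * Y),
          ∑ k ∈ Icc 1 X, ∑ ν ∈ Icc 1 ⌊L⌋₊, c k * (|Ψ (ν * k) u| / u) := hDeq
    _ ≤ ∫ u in (Y / L)..(Real.exp 1 * Y), Real.log x * ((F0 u + E6) * u⁻¹) := hEle
    _ = Real.log x * ((∫ u in (Y / L)..(Real.exp 1 * Y), F0 u / u) + E6 * (1 + Real.log L)) := hEeq
    _ ≤ (12 * K₀ + 2 * C6) * A.size x / Real.log x := hF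

end Literature.NumberTheory.Sieve
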